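import Literature.NumberTheory.EllipticCurves.TwoIsogenyShaTwoTorsionEqPhi
import Literature.NumberTheory.EllipticCurves.Curve388NontrivialSha
import Literature.NumberTheory.EllipticCurves.Curve6137TwoIsogenyDescent
import HarnessLib

/-!
# `Ш(X₃₈₈/ℚ)[2] ≅ (ℤ/2ℤ)²` exactly for the rank-`2` isogeny-door carrier `X₃₈₈ = [0, −388, 0, 676, 0]`
# (Silverman, AEC, Thm. X.4.2(a); the exact sequence `0 → Ш[φ] → Ш[2] → Ш'[φ̂]`)

Topic `NumberTheory/EllipticCurves`. Companion of `TwoIsogenyShaTwoTorsionExamples` for the second rank-`2` row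
`X₃₈₈ = [0, −388, 0, 676, 0]` of route ShaPrimaryTransfer's isogeny-door table (`Curve388*`: `rank = 2`, `t_2 = 0`, `#Ш(X₃₈₈)[φ] = 4`).
The dual side is trivial: for `X'₃₈₈ = [0, 776, 0, 147840, 0]`, `(X')' = [0, -1552, 0, 10816, 0]` and `S(-1552, 10816) ⊆ {1}` (every other class dies modulo a small prime power), so `2^{dim₂ S(-1552,10816)} = #α·#(Ш(X') ∩ im Ξ)` forces `Ш(X'₃₈₈) ∩ im Ξ = ⊥`, and
`TwoIsogenyShaTwoTorsionEqPhi` gives `Ш(X₃₈₈)[2] = Ш(X₃₈₈) ∩ im Ξ`: **`#Ш(X₃₈₈/ℚ)[2] = 4`** at rank `2`. Theorems only.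

## References

* [SilvermanAEC2009] J. H. Silverman, *AEC*, 2nd ed.: Thm. X.4.2(a), Example X.4.10, proof of Prop. X.6.2(c), Prop. X.6.5(b).
-/

noncomputable section

open scoped Classical

namespace Literature.NumberTheory.EllipticCurves

namespace Curve388

open _root_.WeierstrassCurve _root_.WeierstrassCurve.Affine

/-! ## The dual-side Selmer bound `S(-1552, 10816) ⊆ {1}` -/

/-- `S(-1552, 10816)` does not contain: `d = 2, -2, 13, -13` modulo `5`; `d = -1, 26` modulo `9`; `d = -26` modulo `121` (no solution of either chart modulo the stated prime power).
[cite: SilvermanAEC2009, Example X.4.10 (the congruence method)] -/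
theorem not_mem_S_X388dual :
    (-1 : ℤ) ∉ twoIsogenySelmerGroup (-1552) (10816) ∧
      (2 : ℤ) ∉ twoIsogenySelmerGroup (-1552) (10816) ∧
      (-2 : ℤ) ∉ twoIsogenySelmerGroup (-1552) (10816) ∧
      (13 : ℤ) ∉ twoIsogenySelmerGroup (-1552) (10816) ∧
      (-13 : ℤ) ∉ twoIsogenySelmerGroup (-1552) (10816) ∧
      (26 : ℤ) ∉ twoIsogenySelmerGroup (-1552) (10816) ∧
      (-26 : ℤ) ∉ twoIsogenySelmerGroup (-1552) (10816) := by
  have hB : (10816 : ℤ) ≠ 0 := by norm_num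
  haveI : Fact (Nat.Prime 3) := ⟨by norm_num⟩
  haveI : Fact (Nat.Prime 5) := ⟨by norm_num⟩
  haveI : Fact (Nat.Prime 11) := ⟨by norm_num⟩
  refine ⟨?_, ?_, ?_, ?_, ?_, ?_, ?_⟩
  · refine Carrier6137.not_mem_twoIsogenySelmerGroup_of_not_isSoluble hB 3 ?_
    rw [show (10816 : ℤ) / -1 = -10816 by norm_num]
    exact Carrier6137.not_isSoluble_padic_twoIsogenyQuartic_of_zmodPow 2 (by decide)
  · refine Carrier6137.not_mem_twoIsogenySelmerGroup_of_not_isSoluble hB 5 ?_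
    rw [show (10816 : ℤ) / 2 = 5408 by norm_num]
    exact Carrier6137.not_isSoluble_padic_twoIsogenyQuartic_of_zmodPow 1 (by decide)
  · refine Carrier6137.not_mem_twoIsogenySelmerGroup_of_not_isSoluble hB 5 ?_
    rw [show (10816 : ℤ) / -2 = -5408 by norm_num]
    exact Carrier6137.not_isSoluble_padic_twoIsogenyQuartic_of_zmodPow 1 (by decide)
  · refine Carrier6137.not_mem_twoIsogenySelmerGroup_of_not_isSoluble hB 5 ?_
    rw [show (10816 : ℤ) / 13 = 832 by norm_num]
    exact Carrier6137.not_isSoluble_padic_twoIsogenyQuartic_of_zmodPow 1 (by decide)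
  · refine Carrier6137.not_mem_twoIsogenySelmerGroup_of_not_isSoluble hB 5 ?_
    rw [show (10816 : ℤ) / -13 = -832 by norm_num]
    exact Carrier6137.not_isSoluble_padic_twoIsogenyQuartic_of_zmodPow 1 (by decide)
  · refine Carrier6137.not_mem_twoIsogenySelmerGroup_of_not_isSoluble hB 3 ?_
    rw [show (10816 : ℤ) / 26 = 416 by norm_num]
    exact Carrier6137.not_isSoluble_padic_twoIsogenyQuartic_of_zmodPow 2 (by decide)
  · refine Carrier6137.not_mem_twoIsogenySelmerGroup_of_not_isSoluble hB 11 ?_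
    rw [show (10816 : ℤ) / -26 = -416 by norm_num]
    exact Carrier6137.not_isSoluble_padic_twoIsogenyQuartic_of_zmodPow 2 (by decide +kernel)

/-- A squarefree integer dividing `10816` is `±` a divisor of `26`. [cite: SilvermanAEC2009, Prop. X.4.9] -/
private theorem mem_of_dvd_10816 {d : ℤ} (hsq : Squarefree d) (hd : d ∣ (10816 : ℤ)) :
    d ∈ ({1, -1, 2, -2, 13, -13, 26, -26} : Finset ℤ) := by
  have hrad : d ∣ 26 := by
    have h5 : d ∣ (26 : ℤ) ^ 6 := dvd_trans hd ⟨28561, by norm_num⟩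
    exact (hsq.dvd_pow_iff_dvd (by norm_num)).mp h5
  have h1 : d.natAbs ∣ 26 := by
    have := Int.natAbs_dvd_natAbs.mpr hrad
    simpa using this
  have h2 : d.natAbs ∈ Nat.divisors 26 := Nat.mem_divisors.mpr ⟨h1, by norm_num⟩
  rw [show Nat.divisors 26 = {1, 2, 13, 26} by decide] at h2
  simp only [Finset.mem_insert, Finset.mem_singleton] at h2 ⊢
  rcases Int.natAbs_eq d with h | h <;> rw [h] <;>
    rcases h2 with h2 | h2 | h2 | h2 <;> simp [h2]

/-- **`S(-1552, 10816) ⊆ {1}`** (only the class of `O`). [cite: SilvermanAEC2009, Prop. X.4.9 and Example X.4.10] -/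
theorem subset_S_X388dual :
    twoIsogenySelmerGroup (-1552) (10816) ⊆ ({1} : Finset ℤ) := by
  intro d hd
  obtain ⟨hsq, hdvd, -⟩ := (mem_twoIsogenySelmerGroup_iff (a := -1552) (by norm_num : (10816 : ℤ) ≠ 0)).mp hd
  have hmem := mem_of_dvd_10816 hsq hdvd
  obtain ⟨hm1, h2, hm2, h13, hm13, h26, hm26⟩ := not_mem_S_X388dual
  simp only [Finset.mem_insert, Finset.mem_singleton] at hmem ⊢
  rcases hmem with rfl | rfl | rfl | rfl | rfl | rfl | rfl | rfl
  · simp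
  · exact absurd hd hm1
  · exact absurd hd h2
  · exact absurd hd hm2
  · exact absurd hd h13
  · exact absurd hd hm13
  · exact absurd hd h26
  · exact absurd hd hm26

/-! ## `Ш(X'₁₂₁)[φ̂] = 0` and `#Ш(X₃₈₈/ℚ)[2] = 4` -/

/-- **`Ш(X'₁₂₁) ∩ im Ξ = ⊥`** for `X'₁₂₁ = X₃₈₈.twoIsogenyCodomain = [0,776,0,147840,0]`: `2^{dim₂ S(-1552,10816)} = #α·#(Ш(X') ∩ im Ξ)` with
`S(-1552,10816) ⊆ {1}`. [cite: SilvermanAEC2009, Thm. X.4.2(a) with Example X.4.10] -/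
theorem sha_inf_range_dual_eq_bot [(⟨0, -388, 0, 676, 0⟩ : WeierstrassCurve ℚ).IsElliptic] :
    (⟨0, -388, 0, 676, 0⟩ : WeierstrassCurve ℚ).twoIsogenyCodomain.sha ⊓
      (⟨0, -388, 0, 676, 0⟩ : WeierstrassCurve ℚ).twoIsogenyCodomain.twoIsogenyTorsorHom.range = ⊥ := by
  have hV : (⟨0, -388, 0, 676, 0⟩ : WeierstrassCurve ℚ).twoIsogenyCodomain.twoIsogenyCodomain =
      ⟨0, ((-1552 : ℤ) : ℚ), 0, ((10816 : ℤ) : ℚ), 0⟩ := by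
    ext <;> norm_num [twoIsogenyCodomain]
  have hab : (10816 : ℤ) * ((-1552 : ℤ) ^ 2 - 4 * 10816) ≠ 0 := by norm_num
  have key := two_pow_twoIsogenySelmerRank_eq_natCard_mul hab _ hV
  have hs : 2 ^ twoIsogenySelmerRank (-1552) 10816 ≤ 1 := by
    rw [two_pow_twoIsogenySelmerRank_eq_card hab]
    exact (Finset.card_le_card subset_S_X388dual).trans (by decide)
  haveI hE'' : (⟨0, ((-1552 : ℤ) : ℚ), 0, ((10816 : ℤ) : ℚ), 0⟩ : WeierstrassCurve ℚ).IsElliptic := isElliptic_mk_of_ne_zero hab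
  have hα : 1 ≤ Nat.card (Set.range (⟨0, ((-1552 : ℤ) : ℚ), 0, ((10816 : ℤ) : ℚ), 0⟩ : WeierstrassCurve ℚ).xSqClass) := by
    haveI := (natCard_range_xSqClass_le (a := -1552) (b := 10816) hab).1.to_subtype
    exact Nat.card_pos
  have hpos : 0 < 2 ^ twoIsogenySelmerRank (-1552) 10816 := pow_pos (by norm_num) _
  set N := Nat.card ↥((⟨0, -388, 0, 676, 0⟩ : WeierstrassCurve ℚ).twoIsogenyCodomain.sha ⊓
      (⟨0, -388, 0, 676, 0⟩ : WeierstrassCurve ℚ).twoIsogenyCodomain.twoIsogenyTorsorHom.range) with hN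
  have hN1 : N = 1 := by
    rcases Nat.eq_zero_or_pos N with h0 | hNpos
    · rw [h0, mul_zero] at key; omega
    · rcases Nat.lt_or_ge 1 N with h2 | h1 <;> nlinarith
  exact sha_inf_range_eq_bot_of_natCard_eq_one _ hN1

/-- **`Ш(X₃₈₈/ℚ)[2] ≅ (ℤ/2ℤ)²` at rank `2`**: the `2`-torsion subgroup of `Ш(X₃₈₈/ℚ)`, `X₃₈₈ = [0, −388, 0, 676, 0]` (rank `2`, `t_2 = 0`),
has exactly `4` elements. [cite: SilvermanAEC2009, Prop. X.6.5(b) (the method)] -/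
theorem natCard_sha_inf_torsionBy_two [(⟨0, -388, 0, 676, 0⟩ : WeierstrassCurve ℚ).IsElliptic] :
    Nat.card ↥((⟨0, -388, 0, 676, 0⟩ : WeierstrassCurve ℚ).sha ⊓
      AddSubgroup.torsionBy (⟨0, -388, 0, 676, 0⟩ : WeierstrassCurve ℚ).galH1 2) = 4 := by
  rw [sha_inf_torsionBy_two_eq_sha_inf_range _ sha_inf_range_dual_eq_bot]
  exact natCard_sha_inf_range_eq

/-- **The second rank-`2` row in one statement**: `rank X₃₈₈(ℚ) = 2`, `t_2(X₃₈₈) = 0`, `#Ш(X₃₈₈/ℚ)[2] = 4`, `X₃₈₈ ~ Y = [0, −58, 0, −2184, 0] = x(x + 26)(x − 84)` with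
`Ш(Y/ℚ)[2] = 0`. [cite: SilvermanAEC2009, Prop. X.6.5(b) (the method)] [cite: Greenberg1999LNM, §1 pp. 54–57] -/
theorem rankTwo_row [(⟨0, -388, 0, 676, 0⟩ : WeierstrassCurve ℚ).IsElliptic] :
    (⟨0, -388, 0, 676, 0⟩ : WeierstrassCurve ℚ).mordellWeilRank = 2 ∧
      (⟨0, -388, 0, 676, 0⟩ : WeierstrassCurve ℚ).shaCorank 2 = 0 ∧
      Nat.card ↥((⟨0, -388, 0, 676, 0⟩ : WeierstrassCurve ℚ).sha ⊓
        AddSubgroup.torsionBy (⟨0, -388, 0, 676, 0⟩ : WeierstrassCurve ℚ).galH1 2) = 4 ∧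
      IsIsogenous (⟨0, -388, 0, 676, 0⟩ : WeierstrassCurve ℚ) (⟨0, -58, 0, -2184, 0⟩ : WeierstrassCurve ℚ) ∧
      (∀ c ∈ (⟨0, -58, 0, -2184, 0⟩ : WeierstrassCurve ℚ).sha, 2 • c = 0 → c = 0) :=
  ⟨mordellWeilRank_X, shaCorank_X_two, natCard_sha_inf_torsionBy_two, isIsogenous_X_Y, forall_mem_sha_Y_two_smul_eq_zero⟩

end Curve388

end Literature.NumberTheory.EllipticCurves

end
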